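import Mathlib
import Summits.ValiantsHypothesis.ValiantsHypothesis.Theorems.LacunarySymmetroidMatrixDescartesStubInertiaChain
import Summits.ValiantsHypothesis.ValiantsHypothesis.Theorems.SymmetroidPencilBasics

/-!
# `MatrixDescartes` census — DOOR A tool: the GAUGED LOEWNER ROLLE LAW (all sizes `m`, all term counts `K`, all supports)

HONEST FRAMING.  Object-search cell `pub-symmetroid`, door-A seat `val-sym-door-p4` (gen 17); items stmt-ValiantsHypothesis-19979
`DoorA26` / 19980 `DoorA34` (OPEN, typed, never asserted); helper `--supports 19979`, NO closure claim, no definition.  Nothing here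
bounds `ζ_sym(2,6)` or `ζ_sym(3,4)`, decides a door, or bears on `MatrixDescartes` (stmt-ValiantsHypothesis-18050) / `VP ≠ VNP`.

THE LAW (a matrix Budan–Fourier step with ONE real gauge parameter; memo `DOOR-A26-P4G16-REPORT` §4 named it as «the tool that does
bite» for the surviving `(2,4)` law T3D, here typed for every format).  Let `F(x) = ∑ₗ x^{dₗ} Sₗ` be a real symmetric `m × m`
lacunary pencil (`dₗ ∈ ℕ`, any `K`) and `θ ∈ ℝ`.  Its `θ`-GAUGED EULER DERIVATIVE is the pencil
`Q_θ(x) = ∑ₗ (dₗ − θ)·x^{dₗ}·Sₗ` (`= x·F′(x) − θ·F(x)`; `x^{θ+1}·(x^{−θ}F)′ = Q_θ`).  If `Q_θ(x)` is positive definite for every `x`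
of a CLOSED window `[α, β] ⊂ (0, ∞)` (singular end points allowed), then `x ↦ x^{−θ}F(x)` is STRICTLY LOEWNER INCREASING on the
window, and therefore (windowed inertia chain, §1) `det F` has AT MOST `m` distinct roots in `[α, β]` — independently of `K`, of
the exponents and of the letters' signs: `card_roots_window_le_of_gauge_posDef` (§3; `…_negDef` for a negative definite gauge).
Special gauges: `θ = d_top` kills the top letter, `θ = d_bottom` kills the bottom letter; §4 records the TOP-GAUGE corollary used
by T3D: with `d₀ = 0`, interior letters `⪯ 0` and ARBITRARY end letters, `Q_{d_top}` is Loewner non-decreasing, so once it is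
positive definite at some `x₀ > 0` the pencil has at most `m` distinct det-roots in `[x₀, ∞)` (`card_roots_Ici_le_of_topGauge`).

RELATION TO THE TREE (credit where it belongs).  The cell's INERTIA KIT (seat `val-sym-mdr-p2` g16–g21:
`…MatrixDescartesInertiaIndexFormula`, `…InertiaOneType`, `…TwoSidedLoewner`) proves the stronger ONE-TYPE WINDOW LAW: on an OPEN
window with NON-SINGULAR ends whose roots are all of positive type (every kernel vector `u` at a root `t` has `P_u′(t) > 0`) the
roots counted WITH MULTIPLICITY number exactly `π(F(b)) − π(F(a)) ≤ m`.  A definite gauge on the window IMPLIES one-typedness there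
(the type is gauge-invariant: at a kernel vector `uᵀQ_θ(t)u = t·P_u′(t)` for every `θ`), so §3 is a COROLLARY-CLASS statement of that
law; what this file adds is (i) the hypothesis in GAUGE form — checkable from the letters WITHOUT locating the roots, e.g. by Loewner
monotonicity of `Q_θ` in a sign class (§4) —, (ii) closed windows with possibly singular end points, and (iii) a short independent
proof from the landed `stub_inertiaChain` (line `Lift`).  It bounds no door row by itself.

PROOF.  §1 `windowedChain`: clamp the window family to `(0,∞)` (`s ↦ G(clamp s) + (s − β)₊·1`), which is Loewner non-decreasing on
`(0,∞)`, and feed the kernel vectors at the singular times to the landed `stub_inertiaChain` (linear independence of the kernel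
chain).  §2: for a vector `v` the scalar gauge `φ_v(x) = x^{−θ}·vᵀF(x)v = ∑ₗ (vᵀSₗv)·x^{dₗ−θ}` has derivative
`x^{−θ−1}·vᵀQ_θ(x)v > 0` (`Real.hasDerivAt_rpow_const`), hence is strictly increasing on the window (`strictMonoOn_of_deriv_pos`).
§3: `det (x^{−θ}F(x)) = x^{−mθ} det F(x)` and `eval_det_pencil`.  [folklore] Elementary real analysis + linear algebra; Mathlib + two
landed tree modules; axioms standard; no `sorry`, no definitions.
-/

-- the D-0017 layout repeats a namespace component (single-conjunct summit); the `dupNamespace` linter flags it; name mandated.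
set_option linter.dupNamespace false

namespace Summit.ValiantsHypothesis.ValiantsHypothesis.Theorems.LacunarySymmetroidMatrixDescartes.Census.GaugedRolle

open Matrix Finset Polynomial
open scoped BigOperators

/-! ## §1 The windowed inertia chain -/

/-- **Windowed inertia chain.**  A family `G : ℝ → Matrix ι ι ℝ` of real symmetric matrices that is STRICTLY Loewner
increasing on a window `[α, β] ⊂ (0, ∞)` (`G t − G s ≻ 0` for `α ≤ s < t ≤ β`) is singular at no more than `card ι` points of
the window: for every strictly increasing list `τ` of points of `[α, β]` with `det G (τ j) = 0`, its length is `≤ card ι`.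
(Clamp to the window, add `(s − β)₊·1` beyond it, and apply the landed `stub_inertiaChain`.) [folklore] -/
theorem windowedChain (ι : Type) [Fintype ι] [DecidableEq ι] (G : ℝ → Matrix ι ι ℝ)
    (hG : ∀ s, (G s).IsSymm) {α β : ℝ} (hα : 0 < α)
    (hmono : ∀ s t, α ≤ s → s < t → t ≤ β → (G t - G s).PosDef)
    (k : ℕ) (τ : Fin k → ℝ) (hτ : StrictMono τ) (hτα : ∀ j, α ≤ τ j) (hτβ : ∀ j, τ j ≤ β)
    (hdet : ∀ j, (G (τ j)).det = 0) : k ≤ Fintype.card ι := by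
  -- the clamped family
  let π : ℝ → ℝ := fun s => max α (min s β)
  let Gc : ℝ → Matrix ι ι ℝ := fun s => G (π s) + (max (s - β) 0) • (1 : Matrix ι ι ℝ)
  have hαβ : ∀ j, α ≤ β := fun j => (hτα j).trans (hτβ j)
  have hπα : ∀ s, α ≤ π s := fun s => le_max_left _ _
  have hπβ : ∀ s, α ≤ β → π s ≤ β := fun s h => max_le h (min_le_right _ _)
  have hπmono : ∀ s t, s ≤ t → π s ≤ π t := fun s t hst =>
    max_le_max le_rfl (min_le_min hst le_rfl)
  have hπfix : ∀ s, α ≤ s → s ≤ β → π s = s := fun s h1 h2 => by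
    show max α (min s β) = s
    rw [min_eq_left h2, max_eq_right h1]
  -- weak Loewner monotonicity of `G` on the window
  have hmonoW : ∀ s t, α ≤ s → s ≤ t → t ≤ β → (G t - G s).PosSemidef := by
    intro s t h1 hst h2
    rcases hst.lt_or_eq with hlt | heq
    · exact (hmono s t h1 hlt h2).posSemidef
    · rw [heq, sub_self]; exact Matrix.PosSemidef.zero
  have hGc_symm : ∀ s, (Gc s).IsSymm := by
    intro s
    show (G (π s) + (max (s - β) 0) • (1 : Matrix ι ι ℝ)).IsSymm
    unfold Matrix.IsSymm
    rw [Matrix.transpose_add, Matrix.transpose_smul, Matrix.transpose_one, (hG _).eq]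
  have hGc_mono : ∀ s t : ℝ, 0 < s → s ≤ t → (Gc t - Gc s).PosSemidef := by
    intro s t _ hst
    have hsplit : Gc t - Gc s = (G (π t) - G (π s)) + (max (t - β) 0 - max (s - β) 0) • (1 : Matrix ι ι ℝ) := by
      show (G (π t) + (max (t - β) 0) • (1 : Matrix ι ι ℝ)) - (G (π s) + (max (s - β) 0) • 1) = _
      rw [sub_smul]; abel
    rw [hsplit]
    refine Matrix.PosSemidef.add ?_ ?_
    · by_cases hk : k = 0
      · -- no window information needed when `α ≤ β` might fail; but we still have monotonicity via cases
        by_cases hab : α ≤ β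
        · exact hmonoW _ _ (hπα s) (hπmono s t hst) (hπβ t hab)
        · -- if `β < α` then `π` is constant `= α`
          have hc : ∀ u, π u = α := fun u => by
            show max α (min u β) = α
            exact max_eq_left ((min_le_right _ _).trans (le_of_lt (lt_of_not_ge hab)))
          rw [hc, hc, sub_self]; exact Matrix.PosSemidef.zero
      · obtain ⟨j⟩ : Nonempty (Fin k) := Fin.pos_iff_nonempty.mp (Nat.pos_of_ne_zero hk)
        exact hmonoW _ _ (hπα s) (hπmono s t hst) (hπβ t (hαβ j))
    · exact Matrix.PosSemidef.one.smul (sub_nonneg.2 (max_le_max (sub_le_sub_right hst _) le_rfl))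
  -- kernel vectors at the singular times
  have hdata : ∀ j, ∃ v : ι → ℝ, v ≠ 0 ∧ G (τ j) *ᵥ v = 0 := fun j =>
    Matrix.exists_mulVec_eq_zero_iff.2 (hdet j)
  choose v hv0 hker using hdata
  have hGcτ : ∀ j, Gc (τ j) = G (τ j) := fun j => by
    show G (π (τ j)) + (max (τ j - β) 0) • (1 : Matrix ι ι ℝ) = G (τ j)
    rw [hπfix _ (hτα j) (hτβ j), max_eq_right (sub_nonpos.2 (hτβ j)), zero_smul, add_zero]
  have hkerc : ∀ j, Gc (τ j) *ᵥ v j = 0 := fun j => by rw [hGcτ]; exact hker j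
  have hposc : ∀ j (s : ℝ), τ j < s → 0 < v j ⬝ᵥ (Gc s *ᵥ v j) := by
    intro j s hs
    have hτpos : 0 < τ j := hα.trans_le (hτα j)
    show 0 < v j ⬝ᵥ ((G (π s) + (max (s - β) 0) • (1 : Matrix ι ι ℝ)) *ᵥ v j)
    rw [Matrix.add_mulVec, Matrix.smul_mulVec, Matrix.one_mulVec, dotProduct_add, dotProduct_smul, smul_eq_mul]
    have hvv : 0 < v j ⬝ᵥ v j := by
      simpa only [star_trivial] using (dotProduct_star_self_pos_iff.mpr (hv0 j))
    have hquad0 : v j ⬝ᵥ (G (τ j) *ᵥ v j) = 0 := by rw [hker j, dotProduct_zero]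
    rcases lt_or_ge (τ j) (π s) with hlt | hge
    · -- strict increase from `τ j` to `π s` inside the window
      have hπs : π s ≤ β := hπβ s ((hτα j).trans (hτβ j))
      have hpd := hmono (τ j) (π s) (hτα j) hlt hπs
      have h1 : 0 < v j ⬝ᵥ ((G (π s) - G (τ j)) *ᵥ v j) := by
        simpa only [star_trivial] using hpd.dotProduct_mulVec_pos (hv0 j)
      rw [Matrix.sub_mulVec, dotProduct_sub, hquad0, sub_zero] at h1
      have h2 : 0 ≤ max (s - β) 0 * (v j ⬝ᵥ v j) := mul_nonneg (le_max_right _ _) hvv.le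
      linarith
    · -- then `π s = τ j = β < s`
      have hπs_ge : τ j ≤ π s := by
        have := hπmono (τ j) s hs.le
        rwa [hπfix _ (hτα j) (hτβ j)] at this
      have hπeq : π s = τ j := le_antisymm hge hπs_ge
      have hsβ : β < s := by
        by_contra hle
        push Not at hle
        have : π s = s := hπfix s ((hτα j).trans hs.le) hle
        rw [this] at hπeq
        exact (lt_irrefl _) (hπeq ▸ hs)
      rw [hπeq, hquad0, zero_add, max_eq_left (sub_pos.2 hsβ).le]
      exact mul_pos (sub_pos.2 hsβ) hvv
  exact stub_inertiaChain ι Gc hGc_symm hGc_mono k τ hτ (fun j => hα.trans_le (hτα j)) v hkerc hposc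


/-! ## §2 The scalar gauge and strict Loewner monotonicity -/

/-- Derivative of the gauged fewnomial `φ(y) = ∑ₗ cₗ · y^{dₗ − θ}` at `x > 0`:
`φ′(x) = x^{−θ−1} · ∑ₗ (dₗ − θ)·x^{dₗ}·cₗ`. [folklore] -/
theorem hasDerivAt_gaugeSum {K : ℕ} (c : Fin K → ℝ) (d : Fin K → ℕ) (θ : ℝ) {x : ℝ} (hx : 0 < x) :
    HasDerivAt (fun y : ℝ => ∑ l, c l * y ^ ((d l : ℝ) - θ))
      (x ^ (-θ - 1) * ∑ l, ((d l : ℝ) - θ) * x ^ (d l) * c l) x := by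
  have h : HasDerivAt (fun y : ℝ => ∑ l, c l * y ^ ((d l : ℝ) - θ))
      (∑ l, c l * (((d l : ℝ) - θ) * x ^ ((d l : ℝ) - θ - 1))) x := by
    apply HasDerivAt.fun_sum
    intro l _
    exact (Real.hasDerivAt_rpow_const (Or.inl hx.ne')).const_mul (c l)
  convert h using 1
  rw [Finset.mul_sum]
  refine Finset.sum_congr rfl fun l _ => ?_
  have h1 : x ^ ((d l : ℝ) - θ - 1) = x ^ (d l) * x ^ (-θ - 1) := by
    rw [show ((d l : ℝ) - θ - 1) = (d l : ℝ) + (-θ - 1) by ring, Real.rpow_add hx, Real.rpow_natCast]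
  rw [h1]; ring

/-- The gauged fewnomial is strictly increasing on a window `[α, β] ⊂ (0,∞)` on which its gauged Euler derivative
`∑ₗ (dₗ − θ)·x^{dₗ}·cₗ` is positive. [folklore] -/
theorem strictMonoOn_gaugeSum {K : ℕ} (c : Fin K → ℝ) (d : Fin K → ℕ) (θ : ℝ) {α β : ℝ} (hα : 0 < α)
    (hpos : ∀ x, α ≤ x → x ≤ β → 0 < ∑ l, ((d l : ℝ) - θ) * x ^ (d l) * c l) :
    StrictMonoOn (fun y : ℝ => ∑ l, c l * y ^ ((d l : ℝ) - θ)) (Set.Icc α β) := by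
  apply strictMonoOn_of_deriv_pos (convex_Icc α β)
  · intro x hx
    exact (hasDerivAt_gaugeSum c d θ (hα.trans_le hx.1)).continuousAt.continuousWithinAt
  · intro x hx
    rw [interior_Icc] at hx
    rw [(hasDerivAt_gaugeSum c d θ (hα.trans hx.1)).deriv]
    exact mul_pos (Real.rpow_pos_of_pos (hα.trans hx.1) _) (hpos x hx.1.le hx.2.le)

/-- `vᵀ(∑ₗ aₗ • Sₗ)v = ∑ₗ aₗ · vᵀSₗv`. [folklore] -/
theorem quadForm_sum_smul {m K : ℕ} (a : Fin K → ℝ) (S : Fin K → Matrix (Fin m) (Fin m) ℝ) (v : Fin m → ℝ) :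
    v ⬝ᵥ ((∑ l, a l • S l) *ᵥ v) = ∑ l, a l * (v ⬝ᵥ (S l *ᵥ v)) := by
  rw [Matrix.sum_mulVec, dotProduct_sum]
  refine Finset.sum_congr rfl fun l _ => ?_
  rw [Matrix.smul_mulVec, dotProduct_smul, smul_eq_mul]

/-- The real pencil `∑ₗ x^{dₗ} • Sₗ` of symmetric letters is symmetric. [folklore] -/
theorem isSymm_pencil {m K : ℕ} (d : Fin K → ℕ) (S : Fin K → Matrix (Fin m) (Fin m) ℝ)
    (hS : ∀ l, (S l).IsSymm) (x : ℝ) : (∑ l, x ^ (d l) • S l).IsSymm := by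
  unfold Matrix.IsSymm
  rw [Matrix.transpose_sum]
  exact Finset.sum_congr rfl fun l _ => by rw [Matrix.transpose_smul, (hS l).eq]

/-- **Strict Loewner monotonicity under a positive definite gauge.**  If the `θ`-gauged Euler derivative
`Q_θ(x) = ∑ₗ ((dₗ − θ)·x^{dₗ}) • Sₗ` is positive definite on `[α, β]` (`0 < α`), then for `α ≤ s < t ≤ β` the difference
`t^{−θ}·F(t) − s^{−θ}·F(s)` of the gauged pencil `F(x) = ∑ₗ x^{dₗ} • Sₗ` is positive definite. [folklore] -/
theorem gauge_posDef_sub {m K : ℕ} (d : Fin K → ℕ) (S : Fin K → Matrix (Fin m) (Fin m) ℝ)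
    (hS : ∀ l, (S l).IsSymm) (θ : ℝ) {α β : ℝ} (hα : 0 < α)
    (hQ : ∀ x, α ≤ x → x ≤ β → (∑ l, (((d l : ℝ) - θ) * x ^ (d l)) • S l).PosDef)
    {s t : ℝ} (hs : α ≤ s) (hst : s < t) (ht : t ≤ β) :
    (t ^ (-θ) • (∑ l, t ^ (d l) • S l) - s ^ (-θ) • (∑ l, s ^ (d l) • S l)).PosDef := by
  refine Matrix.PosDef.of_dotProduct_mulVec_pos ?_ fun v hv => ?_
  · refine Matrix.isHermitian_iff_isSymm.2 ?_
    unfold Matrix.IsSymm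
    rw [Matrix.transpose_sub, Matrix.transpose_smul, Matrix.transpose_smul, (isSymm_pencil d S hS t).eq,
      (isSymm_pencil d S hS s).eq]
  · set c : Fin K → ℝ := fun l => v ⬝ᵥ (S l *ᵥ v) with hc
    have hφ : ∀ x : ℝ, 0 < x →
        v ⬝ᵥ ((x ^ (-θ) • ∑ l, x ^ (d l) • S l) *ᵥ v) = ∑ l, c l * x ^ ((d l : ℝ) - θ) := by
      intro x hx
      rw [Matrix.smul_mulVec, dotProduct_smul, smul_eq_mul, quadForm_sum_smul, Finset.mul_sum]
      refine Finset.sum_congr rfl fun l _ => ?_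
      rw [show ((d l : ℝ) - θ) = (d l : ℝ) + (-θ) by ring, Real.rpow_add hx, Real.rpow_natCast]
      ring
    have hQv : ∀ x, α ≤ x → x ≤ β → 0 < ∑ l, ((d l : ℝ) - θ) * x ^ (d l) * c l := by
      intro x h1 h2
      have h3 := (hQ x h1 h2).dotProduct_mulVec_pos hv
      rw [star_trivial, quadForm_sum_smul] at h3
      exact h3
    have hmono := strictMonoOn_gaugeSum c d θ hα hQv
    have h := hmono ⟨hs, hst.le.trans ht⟩ ⟨hs.trans hst.le, ht⟩ hst
    rw [star_trivial, Matrix.sub_mulVec, dotProduct_sub, hφ t (hα.trans_le (hs.trans hst.le)),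
      hφ s (hα.trans_le hs)]
    exact sub_pos.2 h

/-! ## §3 The gauged Loewner Rolle law -/

/-- **GAUGED LOEWNER ROLLE LAW (positive definite gauge; all `m`, all `K`, all supports).**  Let `Sₗ` be real symmetric
`m × m` letters on exponents `dₗ ∈ ℕ` and `θ ∈ ℝ`.  If the `θ`-gauged Euler derivative `Q_θ(x) = ∑ₗ ((dₗ − θ)·x^{dₗ}) • Sₗ` is
positive definite for every `x ∈ [α, β]` (`0 < α`), then the determinant of the lacunary pencil `∑ₗ X^{dₗ} • Sₗ` has at most `m`
distinct roots in `[α, β]`. [folklore] -/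
theorem card_roots_window_le_of_gauge_posDef {m K : ℕ} (d : Fin K → ℕ) (S : Fin K → Matrix (Fin m) (Fin m) ℝ)
    (hS : ∀ l, (S l).IsSymm) (θ α β : ℝ) (hα : 0 < α)
    (hQ : ∀ x, α ≤ x → x ≤ β → (∑ l, (((d l : ℝ) - θ) * x ^ (d l)) • S l).PosDef) :
    ((∑ l, (X : ℝ[X]) ^ d l • (S l).map C).det.roots.toFinset.filter
        (fun x => α ≤ x ∧ x ≤ β)).card ≤ m := by
  set p := (∑ l, (X : ℝ[X]) ^ d l • (S l).map C).det with hp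
  by_cases hdet : p = 0
  · simp [hdet]
  set R := p.roots.toFinset.filter (fun x => α ≤ x ∧ x ≤ β) with hR
  let τ : Fin R.card ↪o ℝ := R.orderEmbOfFin rfl
  have hτmem : ∀ j, τ j ∈ R := fun j => R.orderEmbOfFin_mem rfl j
  have hτα : ∀ j, α ≤ τ j := fun j => (Finset.mem_filter.1 (hτmem j)).2.1
  have hτβ : ∀ j, τ j ≤ β := fun j => (Finset.mem_filter.1 (hτmem j)).2.2
  have hτroot : ∀ j, p.IsRoot (τ j) := fun j => by
    have h1 := (Finset.mem_filter.1 (hτmem j)).1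
    rw [Multiset.mem_toFinset] at h1
    exact (Polynomial.mem_roots hdet).1 h1
  -- the gauged family `G(x) = x^{−θ} • F(x)`
  let G : ℝ → Matrix (Fin m) (Fin m) ℝ := fun x => x ^ (-θ) • ∑ l, x ^ (d l) • S l
  have hGsymm : ∀ x, (G x).IsSymm := fun x => by
    show (x ^ (-θ) • ∑ l, x ^ (d l) • S l).IsSymm
    unfold Matrix.IsSymm
    rw [Matrix.transpose_smul, (isSymm_pencil d S hS x).eq]
  have hGmono : ∀ s t, α ≤ s → s < t → t ≤ β → (G t - G s).PosDef := fun s t h1 h2 h3 =>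
    gauge_posDef_sub d S hS θ hα hQ h1 h2 h3
  have hGdet : ∀ j, (G (τ j)).det = 0 := fun j => by
    have h1 : p.eval (τ j) = 0 := hτroot j
    rw [hp, SymmetroidDescartes.eval_det_pencil S d (τ j)] at h1
    show ((τ j) ^ (-θ) • ∑ l, (τ j) ^ (d l) • S l).det = 0
    rw [Matrix.det_smul, h1, mul_zero]
  have h := windowedChain (Fin m) G hGsymm hα hGmono R.card τ τ.strictMono hτα hτβ hGdet
  rwa [Fintype.card_fin] at h

/-- The letters-negated pencil is the negated pencil. [folklore] -/
theorem pencil_neg {m K : ℕ} (d : Fin K → ℕ) (S : Fin K → Matrix (Fin m) (Fin m) ℝ) :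
    (∑ l, (X : ℝ[X]) ^ d l • (-S l).map C) = -(∑ l, (X : ℝ[X]) ^ d l • (S l).map C) := by
  rw [← Finset.sum_neg_distrib]
  refine Finset.sum_congr rfl fun l _ => ?_
  rw [Matrix.map_neg _ (map_neg C), smul_neg]

/-- Negating every letter does not change the set of det-roots. [folklore] -/
theorem roots_toFinset_pencil_neg {m K : ℕ} (d : Fin K → ℕ) (S : Fin K → Matrix (Fin m) (Fin m) ℝ) :
    (∑ l, (X : ℝ[X]) ^ d l • (-S l).map C).det.roots.toFinset
      = (∑ l, (X : ℝ[X]) ^ d l • (S l).map C).det.roots.toFinset := by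
  rw [pencil_neg, Matrix.det_neg, Fintype.card_fin]
  rw [show ((-1 : ℝ[X]) ^ m) = C ((-1 : ℝ) ^ m) by rw [map_pow, map_neg, map_one]]
  rw [Polynomial.roots_C_mul _ (pow_ne_zero _ (by norm_num))]

/-- **GAUGED LOEWNER ROLLE LAW (negative definite gauge).**  Same conclusion when `Q_θ(x) ≺ 0` on the window, written
as `∑ₗ ((θ − dₗ)·x^{dₗ}) • Sₗ ≻ 0`. [folklore] -/
theorem card_roots_window_le_of_gauge_negDef {m K : ℕ} (d : Fin K → ℕ) (S : Fin K → Matrix (Fin m) (Fin m) ℝ)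
    (hS : ∀ l, (S l).IsSymm) (θ α β : ℝ) (hα : 0 < α)
    (hQ : ∀ x, α ≤ x → x ≤ β → (∑ l, ((θ - (d l : ℝ)) * x ^ (d l)) • S l).PosDef) :
    ((∑ l, (X : ℝ[X]) ^ d l • (S l).map C).det.roots.toFinset.filter
        (fun x => α ≤ x ∧ x ≤ β)).card ≤ m := by
  have hS' : ∀ l, (-S l).IsSymm := fun l => (hS l).neg
  have hQ' : ∀ x, α ≤ x → x ≤ β → (∑ l, (((d l : ℝ) - θ) * x ^ (d l)) • (-S l)).PosDef := by
    intro x h1 h2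
    have h := hQ x h1 h2
    have heq : (∑ l, (((d l : ℝ) - θ) * x ^ (d l)) • (-S l)) = ∑ l, ((θ - (d l : ℝ)) * x ^ (d l)) • S l :=
      Finset.sum_congr rfl fun l _ => by rw [smul_neg, ← neg_smul]; ring_nf
    rw [heq]; exact h
  have h := card_roots_window_le_of_gauge_posDef d (fun l => -S l) hS' θ α β hα hQ'
  rwa [roots_toFinset_pencil_neg] at h

/-! ## §4 The top gauge: interior letters of one sign, arbitrary end letters -/

/-- **TOP-GAUGE LAW (all `m`, all `K`).**  Let the bottom exponent be `d_b = 0` and `d_t` the top exponent, let every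
OTHER letter be negative semidefinite, and let the two end letters `S_b, S_t` be ARBITRARY real symmetric.  Then the
top-gauged Euler derivative `Q_{d_t}(x) = ∑ₗ ((dₗ − d_t)·x^{dₗ}) • Sₗ` (in which the top letter does not occur) is Loewner
non-decreasing in `x`, so if it is positive definite at some `x₀ > 0` the pencil has at most `m` distinct det-roots in
`[x₀, ∞)`.  (T3D instance, `m = 2`, `K = 4`: `S₀ − x^aT₁ − x^bT₂ + x^cS₃` with `T₁, T₂ ⪰ 0` has at most two det-roots beyond
the threshold where `(c−a)x^aT₁ + (c−b)x^bT₂ ≻ c·S₀`, whatever `S₃`.) [folklore] -/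
theorem card_roots_Ici_le_of_topGauge {m K : ℕ} (d : Fin K → ℕ) (S : Fin K → Matrix (Fin m) (Fin m) ℝ)
    (hS : ∀ l, (S l).IsSymm) (b t : Fin K) (hb : d b = 0) (ht : ∀ l, d l ≤ d t)
    (hint : ∀ l, l ≠ b → l ≠ t → (-S l).PosSemidef) {x₀ : ℝ} (hx₀ : 0 < x₀)
    (hQ₀ : (∑ l, (((d l : ℝ) - d t) * x₀ ^ (d l)) • S l).PosDef) :
    ((∑ l, (X : ℝ[X]) ^ d l • (S l).map C).det.roots.toFinset.filter (fun x => x₀ ≤ x)).card ≤ m := by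
  -- monotonicity of the top gauge
  have hmonoQ : ∀ y, x₀ ≤ y →
      ((∑ l, (((d l : ℝ) - d t) * y ^ (d l)) • S l) - ∑ l, (((d l : ℝ) - d t) * x₀ ^ (d l)) • S l).PosSemidef := by
    intro y hy
    have heq : (∑ l, (((d l : ℝ) - d t) * y ^ (d l)) • S l) - ∑ l, (((d l : ℝ) - d t) * x₀ ^ (d l)) • S l
        = ∑ l, (((d t : ℝ) - d l) * (y ^ (d l) - x₀ ^ (d l))) • (-S l) := by
      rw [← Finset.sum_sub_distrib]
      refine Finset.sum_congr rfl fun l _ => ?_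
      rw [← sub_smul, smul_neg, ← neg_smul]
      ring_nf
    rw [heq]
    refine Matrix.posSemidef_sum Finset.univ fun l _ => ?_
    by_cases hlb : l = b
    · rw [hlb, hb, pow_zero, pow_zero, sub_self, mul_zero, zero_smul]; exact Matrix.PosSemidef.zero
    by_cases hlt : l = t
    · rw [hlt, sub_self, zero_mul, zero_smul]; exact Matrix.PosSemidef.zero
    refine (hint l hlb hlt).smul (mul_nonneg ?_ ?_)
    · exact sub_nonneg.2 (by exact_mod_cast ht l)
    · exact sub_nonneg.2 (pow_le_pow_left₀ hx₀.le hy _)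
  -- a window containing every root `≥ x₀`
  set p := (∑ l, (X : ℝ[X]) ^ d l • (S l).map C).det with hp
  set β : ℝ := x₀ + ∑ r ∈ p.roots.toFinset, |r| with hβ
  have hwin : p.roots.toFinset.filter (fun x => x₀ ≤ x) = p.roots.toFinset.filter (fun x => x₀ ≤ x ∧ x ≤ β) := by
    refine Finset.filter_congr fun r hr => ⟨fun h => ⟨h, ?_⟩, fun h => h.1⟩
    have h1 : |r| ≤ ∑ r' ∈ p.roots.toFinset, |r'| :=
      Finset.single_le_sum (fun r' _ => abs_nonneg r') hr
    linarith [le_abs_self r, hx₀]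
  rw [hwin]
  refine card_roots_window_le_of_gauge_posDef d S hS (d t) x₀ β hx₀ fun y hy _ => ?_
  have h := Matrix.PosDef.add_posSemidef hQ₀ (hmonoQ y hy)
  rwa [add_sub_cancel] at h

end Summit.ValiantsHypothesis.ValiantsHypothesis.Theorems.LacunarySymmetroidMatrixDescartes.Census.GaugedRolle
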